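import Mathlib
import HarnessLib
import Summits.ResolutionOfSingularities.ResolutionOfSingularities.Theorems.WildQuotientsWildQuotientResolutionS1aKillFamily

/-!
# S1a — THE SEQUENTIAL TWO-PHASE RULE: bounded AUX sequences `AuxTopWithin n` / `AuxAltWithin n`, and its WINNING-STRATEGY induction

[OURS · L1 W4.5c · lead-1 g8 landing plan-1 g12ʼs SIG KA v3 (`L/w45c/W45cKAv3.lean` 8a2e41d7fdf65850, defs verbatim) + the game-side proof] — NOT statements
of the manuscript; counted 0; AI-level work, weaker than expert review. Crux stmt-ResolutionOfSingularities-17941, line `s1a-logminvertex` v6.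

WHY (census v6, D₆-type special line): one admissible centre is ONE weighted regular centre per chart, and for a D₆-type transversal type no single aux
move makes every point over the centre killable — two do (`(4,1,1)` then `(3,1,1)`). So the A-side research statement must allow a BOUNDED SEQUENCE of
aux moves along which `jInf` does not increase and at whose end it drops.
* `GameFrame.GModel.AuxTopWithin n M`, `AuxAltWithin n M` (SIG KA v3 verbatim; `n = 0` = `AuxTopAt` / `AuxAlt`), `auxAltWithin_mono`,
  `auxAltWithin_of_auxTopWithin` ((A3) along sequences, from `auxAlt_of_auxTopAt` p613609);
* `KillOrAuxSeqRuleJInfOn p q G ρ g₀ P`, `killOrAuxSeqRuleJInfOn_of_killOrAuxRuleJInfOn`; `AuxTopWithinReach p`, `auxTopWithinReach_of_auxTopReach`;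
* ★★ **`GameFrame.GModel.wins_of_killOrAuxSeq`** — THE LEXICOGRAPHIC INDUCTION on `(jInf, n, ν₁)`: the sequential rule, relative to a class `P` stable
  under admissible moves with Noetherian bases and finite `ν₁`, makes every `P`-model WIN; `wins_of_killOrAuxSeqRuleJInfOn`.
The `Theses`-cone wrapper (`WinsOfSeqRule p` proved) is `…S1aWinsOfSeqRule`.
-/

set_option linter.dupNamespace false

noncomputable section

open CategoryTheory Limits AlgebraicGeometry TopologicalSpace
open Literature.AlgebraicGeometry.Resolution Literature.AlgebraicGeometry.RelativeSpec
open Summit.ResolutionOfSingularities.ResolutionOfSingularities.Theorems.WildQuotientResolution.S1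
open Summit.ResolutionOfSingularities.ResolutionOfSingularities.Theorems.WildQuotientResolution.S1.NodeAtlas
open Summit.ResolutionOfSingularities.ResolutionOfSingularities.Theorems.WildQuotientResolution.S1.GameFrame
open Summit.ResolutionOfSingularities.ResolutionOfSingularities.Theorems.WildQuotientResolution.S1.KillFamily

namespace Summit.ResolutionOfSingularities.ResolutionOfSingularities.Theorems.WildQuotientResolution.S1

namespace GameFrame.GModel

variable {p : ℕ} {X' X₁ : Scheme.{0}} {q : X' ⟶ X₁} {G : Type} [Group G] {ρ : G →* Aut X'} {g₀ : G}

/-- **`AuxTopWithin n M`** (plan-1 SIG KA v3, verbatim; OURS CANDIDATE research statement, asserted nowhere): `jInf` drops after AT MOST `n + 1` AUX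
moves — `n = 0`: `AuxTopAt M`; `n + 1`: either `AuxTopAt M`, or there is an AUX-admissible centre `(𝒦, d)` such that along EVERY move of it `jInf` does
NOT increase and the moved model satisfies `AuxTopWithin n`. Census recipe for `n = 1` (D₆-type special line): `(4,1,1)` then `(3,1,1)`; heuristic
`n + 1 ≤` embedded-resolution length of the transversal plane-curve type (THETA-LP-CENSUS v6). [OURS · L1 W4.5c] -/
def AuxTopWithin : ℕ → GModel p q G ρ g₀ → Prop
  | 0, M => M.AuxTopAt
  | n + 1, M => M.AuxTopAt ∨
      ∃ (𝒦 : ReesFiltration M.V) (d : ℕ), IsAuxCentre p M.act g₀ 𝒦 d (M.badLocus)ᶜ ∧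
        ∀ M' : GModel p q G ρ g₀, M.IsMoveOf M' 𝒦 d → M'.jInf ≤ M.jInf ∧ AuxTopWithin n M'

/-- **`AuxAltWithin n M`** (SIG KA v3, verbatim): the same recursion with the AUX alternative `AuxAlt` (strict `jInf` drop along every move) at the
leaves — the form the winning-strategy induction consumes. [OURS · L1 W4.5c] -/
def AuxAltWithin : ℕ → GModel p q G ρ g₀ → Prop
  | 0, M => M.AuxAlt
  | n + 1, M => M.AuxAlt ∨
      ∃ (𝒦 : ReesFiltration M.V) (d : ℕ), IsAuxCentre p M.act g₀ 𝒦 d (M.badLocus)ᶜ ∧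
        ∀ M' : GModel p q G ρ g₀, M.IsMoveOf M' 𝒦 d → M'.jInf ≤ M.jInf ∧ AuxAltWithin n M'

/-- Unfolding at `0`. -/
@[simp] theorem auxTopWithin_zero (M : GModel p q G ρ g₀) : AuxTopWithin 0 M ↔ M.AuxTopAt := Iff.rfl

/-- Unfolding at `0`. -/
@[simp] theorem auxAltWithin_zero (M : GModel p q G ρ g₀) : AuxAltWithin 0 M ↔ M.AuxAlt := Iff.rfl

/-- `AuxTopAt` is every `AuxTopWithin n`. -/
theorem auxTopWithin_of_auxTopAt {M : GModel p q G ρ g₀} (h : M.AuxTopAt) : ∀ n : ℕ, AuxTopWithin n M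
  | 0 => h
  | _ + 1 => Or.inl h

/-- `AuxAlt` is every `AuxAltWithin n`. -/
theorem auxAltWithin_of_auxAlt {M : GModel p q G ρ g₀} (h : M.AuxAlt) : ∀ n : ℕ, AuxAltWithin n M
  | 0 => h
  | _ + 1 => Or.inl h

/-- `AuxAltWithin` is monotone in `n`. -/
theorem auxAltWithin_mono : ∀ {n m : ℕ}, n ≤ m → ∀ {M : GModel p q G ρ g₀}, AuxAltWithin n M → AuxAltWithin m M
  | 0, m, _, M, h => auxAltWithin_of_auxAlt h m
  | n + 1, 0, hnm, _, _ => absurd hnm (Nat.not_succ_le_zero n)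
  | n + 1, m + 1, hnm, M, h => by
      rcases h with h | ⟨𝒦, d, haux, hmv⟩
      · exact Or.inl h
      · exact Or.inr ⟨𝒦, d, haux, fun M' hm => ⟨(hmv M' hm).1, auxAltWithin_mono (Nat.le_of_succ_le_succ hnm) (hmv M' hm).2⟩⟩

/-- **(A3) along sequences**: `AuxTopWithin n M → AuxAltWithin n M` on models with Noetherian base (all models of a crux datum, `hasNoetherianBase_of_datum`),
from `auxAlt_of_auxTopAt` (p613609) by induction on `n`. [OURS · L1 W4.5c · plan-1 SIG KA v3] -/
theorem auxAltWithin_of_auxTopWithin [Finite G] (hp : p.Prime) (hG : ∀ g : G, g ∈ Subgroup.zpowers g₀)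
    (hB : ∀ M : GModel p q G ρ g₀, M.HasNoetherianBase) :
    ∀ (n : ℕ) (M : GModel p q G ρ g₀), AuxTopWithin n M → AuxAltWithin n M
  | 0, M, h => auxAlt_of_auxTopAt hp hG M (hB M) h
  | n + 1, M, h => by
      rcases h with h | ⟨𝒦, d, haux, hmv⟩
      · exact Or.inl (auxAlt_of_auxTopAt hp hG M (hB M) h)
      · exact Or.inr ⟨𝒦, d, haux, fun M' hm =>
          ⟨(hmv M' hm).1, auxAltWithin_of_auxTopWithin hp hG hB n M' (hmv M' hm).2⟩⟩

/-! ## The winning-strategy induction for the sequential rule -/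

/-- ★★ **THE SEQUENTIAL TWO-PHASE RULE WINS** (lexicographic induction on `(jInf, n, ν₁)`): let `P` be a class of models stable under admissible moves, with
Noetherian bases and finite `ν₁`; if at every non-terminal `P`-model EITHER a principal centre meeting every bad component with `jInf` non-increasing on
its moves exists (KILL), OR `AuxAltWithin n M` holds for some `n` (a bounded AUX sequence ending in a strict `jInf` drop), then every `P`-model WINS.
[OURS · L1 W4.5c] -/
theorem wins_of_killOrAuxSeq [Finite G] (hp : p.Prime) (hG : ∀ g : G, g ∈ Subgroup.zpowers g₀) (P : GModel p q G ρ g₀ → Prop)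
    (hPmove : ∀ (M M' : GModel p q G ρ g₀) (𝒦 : ReesFiltration M.V) (d : ℕ),
      P M → IsAdmissibleCentre p M.act g₀ 𝒦 d → M.IsMoveOf M' 𝒦 d → P M')
    (hB : ∀ M : GModel p q G ρ g₀, P M → M.HasNoetherianBase) (hnu : ∀ M : GModel p q G ρ g₀, P M → ∃ n : ℕ, M.nu1 < n)
    (H : ∀ M : GModel p q G ρ g₀, P M → ¬ M.Terminal →
      (∃ (𝒦 : ReesFiltration M.V) (d : ℕ), IsPrincipalCentre p M.act g₀ 𝒦 d ∧
        (∀ t ∈ irreducibleComponents ↥M.badLocus, ∃ x ∈ t, (x : M.V) ∈ M.principalKillOpen 𝒦 d) ∧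
        ∀ M' : GModel p q G ρ g₀, M.IsMoveOf M' 𝒦 d → M'.jInf ≤ M.jInf) ∨
      (∃ n : ℕ, AuxAltWithin n M))
    (M₀ : GModel p q G ρ g₀) (hP₀ : P M₀) : Wins p q G ρ g₀ M₀ := by
  obtain ⟨n₀, hn₀⟩ := hnu M₀ hP₀
  suffices main : ∀ (a : ℕ) (M : GModel p q G ρ g₀), P M → M.jInf < a → Wins p q G ρ g₀ M from
    main n₀ M₀ hP₀ (lt_of_le_of_lt M₀.jInf_le_nu1 hn₀)
  intro a
  induction a using Nat.strong_induction_on with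
  | _ a iha =>
    -- strict `jInf` drops are handled by the outer hypothesis
    have drop : ∀ M M' : GModel p q G ρ g₀, P M' → M.jInf < a → M'.jInf < M.jInf → Wins p q G ρ g₀ M' := fun M M' hP' ha hj => by
      cases a with
      | zero => exact absurd (withBot_eq_bot_of_lt_zero ha ▸ hj) not_lt_bot
      | succ a' => exact iha a' (Nat.lt_succ_self a') M' hP' (lt_of_lt_of_le hj (withBot_le_of_lt_succ ha))
    -- bounded AUX sequences, by induction on their length
    have seq : ∀ (n : ℕ) (M : GModel p q G ρ g₀), P M → M.jInf < a → AuxAltWithin n M → Wins p q G ρ g₀ M := by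
      intro n
      induction n with
      | zero =>
        intro M hPM ha h
        obtain ⟨𝒦, d, haux, hmoves⟩ := h
        exact Wins.of_moves 𝒦 d haux.1 fun M' hmv => drop M M' (hPmove M M' 𝒦 d hPM haux.1 hmv) ha (hmoves M' hmv)
      | succ n ihn =>
        intro M hPM ha h
        rcases h with h | ⟨𝒦, d, haux, hmoves⟩
        · obtain ⟨𝒦, d, haux, hmoves⟩ := h
          exact Wins.of_moves 𝒦 d haux.1 fun M' hmv => drop M M' (hPmove M M' 𝒦 d hPM haux.1 hmv) ha (hmoves M' hmv)
        · exact Wins.of_moves 𝒦 d haux.1 fun M' hmv =>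
            ihn M' (hPmove M M' 𝒦 d hPM haux.1 hmv) (lt_of_le_of_lt (hmoves M' hmv).1 ha) (hmoves M' hmv).2
    -- KILL moves lower `ν₁`: induction on a bound for `ν₁`
    have kill : ∀ (m : ℕ) (M : GModel p q G ρ g₀), P M → M.jInf < a → M.nu1 < m → Wins p q G ρ g₀ M := by
      intro m
      induction m with
      | zero => exact fun M _ _ hm => Wins.terminal M (M.terminal_of_nu1_lt_zero hm)
      | succ m ihm =>
        intro M hPM ha hm
        by_cases hT : M.Terminal
        · exact Wins.terminal M hT
        rcases H M hPM hT with ⟨𝒦, d, hprin, hhit, hmoves⟩ | ⟨n, hn⟩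
        · refine Wins.of_moves 𝒦 d (isAdmissibleCentre_of_isPrincipalCentre hprin) fun M' hmv => ?_
          have hPM' := hPmove M M' 𝒦 d hPM (isAdmissibleCentre_of_isPrincipalCentre hprin) hmv
          have hj := hmoves M' hmv
          obtain ⟨π', hbl, -, hr, hcomm⟩ := hmv
          obtain ⟨R₀, _, _, s, _, hs⟩ := hB M hPM
          exact ihm M' hPM' (lt_of_le_of_lt hj ha)
            (nu1_principalMove_lt hp hG M M' 𝒦 d hprin hhit π' hbl hr hcomm s hs (withBot_le_of_lt_succ hm))
        · exact seq n M hPM ha hn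
    intro M hPM ha
    obtain ⟨m, hm⟩ := hnu M hPM
    exact kill m M hPM ha hm

end GameFrame.GModel

/-! ## The sequential rule relative to a class, and the datum-relative A-side residual v3 -/

/-- **THE SEQUENTIAL TWO-PHASE RULE relative to a class `P`** (plan-1 SIG KA v3, verbatim): as `KillOrAuxRuleJInfOn` (p606842) with the AUX branch relaxed
to «`jInf` drops after a BOUNDED number of aux moves along which it does not increase» (`∃ n, AuxAltWithin n M`). [OURS · L1 W4.5c · CANDIDATE shape] -/
def KillOrAuxSeqRuleJInfOn (p : ℕ) {X' X₁ : Scheme.{0}} (q : X' ⟶ X₁) (G : Type) [Group G] (ρ : G →* Aut X') (g₀ : G)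
    (P : GameFrame.GModel p q G ρ g₀ → Prop) : Prop :=
  ∀ M : GameFrame.GModel p q G ρ g₀, P M → M.HasNoetherianBase → ¬ M.Terminal →
    (∃ (𝒦 : ReesFiltration M.V) (d : ℕ), IsPrincipalCentre p M.act g₀ 𝒦 d ∧
      (∀ t ∈ irreducibleComponents ↥M.badLocus, ∃ x ∈ t, (x : M.V) ∈ M.principalKillOpen 𝒦 d) ∧
      ∀ M' : GameFrame.GModel p q G ρ g₀, M.IsMoveOf M' 𝒦 d → P M' ∧ M'.jInf ≤ M.jInf) ∨
    (∃ n : ℕ, GameFrame.GModel.AuxAltWithin n M)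

/-- The one-step rule is the sequential rule with `n = 0`. [OURS · L1 W4.5c · plan-1 SIG KA v3] -/
theorem killOrAuxSeqRuleJInfOn_of_killOrAuxRuleJInfOn {p : ℕ} {X' X₁ : Scheme.{0}} {q : X' ⟶ X₁} {G : Type} [Group G]
    {ρ : G →* Aut X'} {g₀ : G} {P : GameFrame.GModel p q G ρ g₀ → Prop}
    (h : KillOrAuxRuleJInfOn p q G ρ g₀ P) : KillOrAuxSeqRuleJInfOn p q G ρ g₀ P := by
  intro M hPM hB hT
  rcases h M hPM hB hT with hK | ⟨𝒦, d, haux, hmv⟩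
  · exact Or.inl hK
  · exact Or.inr ⟨0, 𝒦, d, haux, fun M' hm => (hmv M' hm).2⟩

/-- **The sequential rule relative to a move-stable class wins** (models over a field: Noetherian bases and finite `ν₁` supplied by the caller).
[OURS · L1 W4.5c] -/
theorem GameFrame.GModel.wins_of_killOrAuxSeqRuleJInfOn {p : ℕ} (hp : p.Prime) {X' X₁ : Scheme.{0}} {q : X' ⟶ X₁} {G : Type} [Group G] [Finite G]
    {ρ : G →* Aut X'} {g₀ : G} (hG : ∀ g : G, g ∈ Subgroup.zpowers g₀) {P : GameFrame.GModel p q G ρ g₀ → Prop}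
    (hPmove : ∀ (M M' : GameFrame.GModel p q G ρ g₀) (𝒦 : ReesFiltration M.V) (d : ℕ),
      P M → IsAdmissibleCentre p M.act g₀ 𝒦 d → M.IsMoveOf M' 𝒦 d → P M')
    (hB : ∀ M : GameFrame.GModel p q G ρ g₀, P M → M.HasNoetherianBase)
    (hnu : ∀ M : GameFrame.GModel p q G ρ g₀, P M → ∃ n : ℕ, M.nu1 < n)
    (hrule : KillOrAuxSeqRuleJInfOn p q G ρ g₀ P) (M₀ : GameFrame.GModel p q G ρ g₀) (hP₀ : P M₀) : Wins p q G ρ g₀ M₀ := by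
  refine GameFrame.GModel.wins_of_killOrAuxSeq hp hG P hPmove hB hnu (fun M hPM hT => ?_) M₀ hP₀
  rcases hrule M hPM (hB M hPM) hT with ⟨𝒦, d, hprin, hhit, hmoves⟩ | hA
  · exact Or.inl ⟨𝒦, d, hprin, hhit, fun M' hmv => (hmoves M' hmv).2⟩
  · exact Or.inr hA

/-- **`AuxTopWithinReach p`** (plan-1 SIG KA v3, verbatim) — `∃ n, AuxTopWithin n M` at every reachable, non-terminal model with `jInf ≠ ⊥` of a crux datum
(binders of `AuxTopReach p`): the datum-relative A-side RESIDUAL OF RECORD v3 (STRATEGY-DESIGN v3.6 §1). [OURS · L1 W4.5c · CANDIDATE, asserted nowhere] -/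
def AuxTopWithinReach (p : ℕ) : Prop :=
  ∀ (k : Type) [Field k] [CharP k p] [PerfectField k] (X' X₁ : Scheme.{0})
    (f : X₁ ⟶ Spec (.of k)) (q : X' ⟶ X₁) (G : Type) [Group G] [Finite G]
    (ρ : G →* Aut X'), Nat.card G = p → IsSeparated f → LocallyOfFiniteType f → QuasiCompact f →
    IsIntegral X₁ → ∀ [IsIntegral X'], Scheme.IsRegular X' → IsFinite q → Function.Surjective q.base →
    (∃ U : X₁.Opens, Dense (U : Set X₁) ∧ Etale (q ∣_ U)) →
    ∀ (hq : ∀ g : G, (ρ g).hom ≫ q = q),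
    (∀ x y : X', q.base x = q.base y → ∃ g : G, (ρ g).hom.base x = y) →
    topologicalKrullDim X₁ ≤ 4 → Function.Injective ρ →
    ∀ (g₀ : G), (∀ g : G, g ∈ Subgroup.zpowers g₀) → ∀ [IsLocallyNoetherian X']
      (h₀ : NodeAtlas p (⟨ρ, hq⟩ : ActionOver q G) g₀),
      ∀ M : GameFrame.GModel p q G ρ g₀, (GameFrame.GModel.initial hq h₀).Reachable M → ¬ M.Terminal →
        M.jInf ≠ ⊥ → ∃ n : ℕ, GameFrame.GModel.AuxTopWithin n M

/-- `AuxTopReach p ⇒ AuxTopWithinReach p` (`n = 0`). [OURS · L1 W4.5c · plan-1 SIG KA v3] -/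
theorem auxTopWithinReach_of_auxTopReach {p : ℕ} (h : AuxTopReach p) : AuxTopWithinReach p := by
  intro k _ _ _ X' X₁ f q G _ _ ρ hG hfs hflft hfqc hX₁ _ hreg hqfin hqsurj hU hq horb hdim hinj g₀ hg₀ _ h₀ M hM hT hj
  exact ⟨0, h k X' X₁ f q G ρ hG hfs hflft hfqc hX₁ hreg hqfin hqsurj hU hq horb hdim hinj g₀ hg₀ h₀ M hM hT hj⟩

end Summit.ResolutionOfSingularities.ResolutionOfSingularities.Theorems.WildQuotientResolution.S1

end
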